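import Mathlib

/-!
# STD₂[12;6]: the order of a semiregular automorphism group — the Sylow step of family F-SR9 (kernel)
Framing: lottery ticket; floor = certified bounds/negative ranges.

Cell pub-namedobj (venture DiscreteObjects), target (M), designs g7, family F-SR9 (HOME
`pub-namedobj-designs-g7/FAMILY-SR9.md`).  A group `G` of automorphisms of an STD₂[12;6] acting semiregularly
(= freely) on the 72 points has `|G| ∣ 72`, and every subgroup of `G` again acts semiregularly.  The census
F-SR9 decides by exhaustive orbit-matrix + group-ring search (two implementations, hub-local) that NO group of
order 9 (Z₉, Z₃×Z₃), of order 8 (all five groups) or of order 12 (all five groups) acts semiregularly on the points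
and blocks of an STD₂[12;6].  The only non-computational inference from these three facts to the census sentence
'every automorphism group of an STD₂[12;6] acting semiregularly on points and blocks has order 1, 2, 3, 4 or 6'
is the Sylow step below, stated purely group-theoretically: a finite group of order dividing 72 with no subgroup of
order 8, none of order 9, and order ≠ 12 has order ∈ {1,2,3,4,6}.  (The three hypotheses are exactly what the
searches establish for semiregular automorphism groups, since semiregularity passes to subgroups.)  Ours; no `sorry`.
-/

namespace Summit.Ventures.DiscreteObjects.STD

/-- **Sylow step of F-SR9.**  If `|G| ∣ 72`, `G` has no subgroup of order `8`, no subgroup of order `9`, and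
`|G| ≠ 12`, then `|G| ∈ {1, 2, 3, 4, 6}`. -/
theorem card_mem_of_no_subgroup_eight_nine {G : Type*} [Group G] [Finite G]
    (h72 : Nat.card G ∣ 72) (h8 : ∀ H : Subgroup G, Nat.card H ≠ 8) (h9 : ∀ H : Subgroup G, Nat.card H ≠ 9)
    (h12 : Nat.card G ≠ 12) : Nat.card G ∈ ({1, 2, 3, 4, 6} : Finset ℕ) := by
  -- no subgroup of order 8 = 2^3  ⇒  ¬ 2^3 ∣ |G|   (Sylow: a p-power dividing |G| is the order of a subgroup)
  haveI : Fact (Nat.Prime 2) := ⟨Nat.prime_two⟩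
  haveI : Fact (Nat.Prime 3) := ⟨Nat.prime_three⟩
  have h8' : ¬ 2 ^ 3 ∣ Nat.card G := by
    intro hd
    obtain ⟨H, hH⟩ := Sylow.exists_subgroup_card_pow_prime 2 hd
    exact h8 H (by simpa using hH)
  have h9' : ¬ 3 ^ 2 ∣ Nat.card G := by
    intro hd
    obtain ⟨H, hH⟩ := Sylow.exists_subgroup_card_pow_prime 3 hd
    exact h9 H (by simpa using hH)
  -- |G| is a divisor of 72; finish by a finite check over the divisors of 72
  have hpos : 0 < Nat.card G := Nat.card_pos
  have hmem : Nat.card G ∈ Nat.divisors 72 := Nat.mem_divisors.mpr ⟨h72, by norm_num⟩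
  have key : ∀ d ∈ Nat.divisors 72, ¬ 2 ^ 3 ∣ d → ¬ 3 ^ 2 ∣ d → d ≠ 12 → d ∈ ({1, 2, 3, 4, 6} : Finset ℕ) := by
    decide
  exact key _ hmem h8' h9' h12

/-- Corollary in the form used by the census: with `|G| ∣ 72` and the three exclusions, `|G| ≤ 6`. -/
theorem card_le_six_of_no_subgroup_eight_nine {G : Type*} [Group G] [Finite G]
    (h72 : Nat.card G ∣ 72) (h8 : ∀ H : Subgroup G, Nat.card H ≠ 8) (h9 : ∀ H : Subgroup G, Nat.card H ≠ 9)
    (h12 : Nat.card G ≠ 12) : Nat.card G ≤ 6 := by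
  have h := card_mem_of_no_subgroup_eight_nine h72 h8 h9 h12
  simp only [Finset.mem_insert, Finset.mem_singleton] at h
  omega

/-- **Order-6 step of F-SR9 (session 2).**  If in addition no subgroup of `G` has order `6` (the census
excludes every group of order 6 — `Z₆` and `S₃` — acting semiregularly on the points and blocks of an
STD₂[12;6], FAMILY-SR9 §6e), then `|G| ∈ {1, 2, 3, 4}`: the divisors `18, 24, 36, 72` of `72` already contain a
subgroup of order `8` or `9`, `12` and `6` are excluded directly (note that a group of order `12` need not
contain one of order `6`, e.g. `A₄`, so `h12` is kept as a separate hypothesis). Purely group-theoretic; ours. -/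
theorem card_mem_of_no_subgroup_eight_nine_six {G : Type*} [Group G] [Finite G]
    (h72 : Nat.card G ∣ 72) (h8 : ∀ H : Subgroup G, Nat.card H ≠ 8) (h9 : ∀ H : Subgroup G, Nat.card H ≠ 9)
    (h12 : Nat.card G ≠ 12) (h6 : ∀ H : Subgroup G, Nat.card H ≠ 6) :
    Nat.card G ∈ ({1, 2, 3, 4} : Finset ℕ) := by
  have h := card_mem_of_no_subgroup_eight_nine h72 h8 h9 h12
  have h6' : Nat.card G ≠ 6 := by
    intro hc
    apply h6 ⊤
    rw [Subgroup.card_top]; exact hc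
  simp only [Finset.mem_insert, Finset.mem_singleton] at h ⊢
  omega

/-- Corollary: under the four exclusions a semiregular automorphism group has order at most `4`. -/
theorem card_le_four_of_no_subgroup_eight_nine_six {G : Type*} [Group G] [Finite G]
    (h72 : Nat.card G ∣ 72) (h8 : ∀ H : Subgroup G, Nat.card H ≠ 8) (h9 : ∀ H : Subgroup G, Nat.card H ≠ 9)
    (h12 : Nat.card G ≠ 12) (h6 : ∀ H : Subgroup G, Nat.card H ≠ 6) : Nat.card G ≤ 4 := by
  have h := card_mem_of_no_subgroup_eight_nine_six h72 h8 h9 h12 h6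
  simp only [Finset.mem_insert, Finset.mem_singleton] at h
  omega

end Summit.Ventures.DiscreteObjects.STD
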